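import Mathlib
import Summits.Ventures.PercRepro2.Defs
import Summits.Ventures.PercRepro2.Graph
import Summits.Ventures.PercRepro2.Harris
import Summits.Ventures.PercRepro2.Events
import Summits.Ventures.PercRepro2.Independence
import Summits.Ventures.PercRepro2.Induced
import Summits.Ventures.PercRepro2.Exploration
import Summits.Ventures.PercRepro2.GateDefs
import Summits.Ventures.PercRepro2.GateAnatomy
import Summits.Ventures.PercRepro2.GateForest
import Summits.Ventures.PercRepro2.GateLSM
import Summits.Ventures.PercRepro2.HullTree
import Summits.Ventures.PercRepro2.GateFeedbackForest
import Summits.Ventures.PercRepro2.GateFeedback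
import Summits.Ventures.PercRepro2.GateFeedbackExit
import Summits.Ventures.PercRepro2.GateContract
import Summits.Ventures.PercRepro2.GateShadow
import Summits.Ventures.PercRepro2.GateSide
import Summits.Ventures.PercRepro2.GateSep

/-!
# The near region of a gate instance and its events (blind cell PercRepro2, mine-c g10;
proofs/MINEC-FEEDBACK.md §12, Theorem 12.1)

Restriction of the edge family to an edge set `F` (`resF`, `endsR`, `pR`) with the marginalisation
`prob_resF_preimage`; the NEAR REGION `near ends s t w` (the vertices hidden neither behind `t` nor
behind `w`) and its edges `nearEdges`; the two events of the class-B mass are events of `G[near]`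
pulled back (`clusterEvent_eq_preimage`, `connDelEvent_eq_preimage` — a closure argument without
path machinery). Used by `GateRestrict` for `massB_restrict`.
-/



namespace Summit.Ventures.PercRepro2

namespace GateNear

open scoped Classical


variable {V : Type*} {E : Type*} [Fintype E] [Fintype V]
variable {R : Type*} [Field R] [LinearOrder R] [IsStrictOrderedRing R]

/-! ## Restriction of the edge family to a set of edges, and marginalisation -/

section Marginal

variable (F : Set E)

omit [Fintype E] [Fintype V] in
/-- Restriction of a configuration to the edges of `F`. -/
def resF (ω : Config E) : Config {e // e ∈ F} := fun e => ω e.1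

omit [Fintype E] [Fintype V] in
/-- The edge family `G[F]` on the subtype of edges of `F`. -/
def endsR (ends : E → Sym2 V) : {e // e ∈ F} → Sym2 V := fun e => ends e.1

omit [Fintype E] [Fintype V] [LinearOrder R] [IsStrictOrderedRing R] in
/-- The weights of `G[F]`. -/
def pR (p : E → R) : {e // e ∈ F} → R := fun e => p e.1

omit [Fintype E] [Fintype V] [IsStrictOrderedRing R] in
/-- The restricted weights are admissible. -/
lemma IsProbVec.pR {p : E → R} (hp : IsProbVec p) : IsProbVec (pR F p) :=
  ⟨fun e => hp.nonneg e.1, fun e => hp.le_one e.1⟩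

omit [Fintype E] [Fintype V] in
/-- Restriction inverts gluing. -/
lemma resF_glue (σ₁ : {e // e ∈ F} → Bool) (σ₂ : {e // e ∉ F} → Bool) :
    resF F (glue F σ₁ σ₂) = σ₁ := by
  funext e
  exact glue_apply_of_mem F σ₁ σ₂ e.2

omit [Fintype V] [LinearOrder R] [IsStrictOrderedRing R] in
/-- **Marginalisation**: the probability of an event of `G[F]` pulled back to `G`. -/
lemma prob_resF_preimage (p : E → R) (A : Set (Config {e // e ∈ F})) :
    prob p (resF F ⁻¹' A) = prob (pR F p) A := by
  rw [prob_eq_expect_indicator, expect_eq_sum_glue p _ F]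
  have h1 : ∀ σ₁ σ₂, (resF F ⁻¹' A).indicator (1 : Config E → R) (glue F σ₁ σ₂)
      = A.indicator 1 σ₁ := by
    intro σ₁ σ₂
    simp only [Set.indicator, Set.mem_preimage, resF_glue, Pi.one_apply]
  simp_rw [h1]
  rw [prob_eq_expect_indicator, expect]
  have h2 : ∀ σ₁ : Config {e // e ∈ F}, ∑ σ₂ : Config {e // e ∉ F},
      weight (fun i : {e // e ∈ F} => p i.1) σ₁ *
        weight (fun i : {e // e ∉ F} => p i.1) σ₂ * A.indicator 1 σ₁
      = weight (pR F p) σ₁ * A.indicator 1 σ₁ := by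
    intro σ₁
    have : ∑ σ₂ : Config {e // e ∉ F},
        weight (fun i : {e // e ∉ F} => p i.1) σ₂ = 1 := sum_weight _
    rw [← Finset.sum_mul, ← Finset.mul_sum, this, mul_one]
    rfl
  simp_rw [h2]

omit [Fintype E] [Fintype V] in
/-- The open graph of `G[F]` is a subgraph of the open graph of `G`. -/
lemma openGraph_resF_le (ends : E → Sym2 V) (ω : Config E) :
    openGraph (endsR F ends) (resF F ω) ≤ openGraph ends ω := by
  intro x y hxy
  rw [openGraph_adj] at hxy ⊢
  obtain ⟨hne, e, he, hends⟩ := hxy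
  exact ⟨hne, e.1, he, hends⟩

omit [Fintype E] [Fintype V] in
/-- A connection in `G[F]` is a connection in `G`. -/
lemma conn_of_connR {ends : E → Sym2 V} {ω : Config E} {x y : V}
    (h : Conn (endsR F ends) (resF F ω) x y) : Conn ends ω x y :=
  h.mono (openGraph_resF_le F ends ω)

end Marginal

/-! ## The near region -/

section Near

variable {ends : E → Sym2 V}

omit [Fintype E] [Fintype V] in
/-- The near region of the instance `(s, t, w)`: not hidden behind `t`, not hidden behind `w`. -/
def near (ends : E → Sym2 V) (s t w : V) : Set V :=
  (GateSide.side ends w s ∪ GateSide.side ends w t ∪ {w}) ∩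
    (GateSide.side ends t s ∪ GateSide.side ends t w ∪ {t})

omit [Fintype E] [Fintype V] in
/-- The avoided vertex is near. -/
lemma t_mem_near {s t w : V} (_htw : t ≠ w) : t ∈ near ends s t w :=
  ⟨Or.inl (Or.inr (GateSide.mem_side_self w t)), Or.inr rfl⟩

omit [Fintype E] [Fintype V] in
/-- The exit vertex is near. -/
lemma w_mem_near {s t w : V} (_htw : t ≠ w) : w ∈ near ends s t w :=
  ⟨Or.inr rfl, Or.inl (Or.inr (GateSide.mem_side_self t w))⟩

omit [Fintype E] [Fintype V] in
/-- A vertex on the root's side of both `t` and `w` is near. -/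
lemma mem_near_of_sides {s t w v : V} (h₁ : v ∈ GateSide.side ends w s)
    (h₂ : v ∈ GateSide.side ends t s) : v ∈ near ends s t w :=
  ⟨Or.inl (Or.inl h₁), Or.inl (Or.inl h₂)⟩

omit [Fintype E] [Fintype V] in
/-- The edges inside the near region (an opaque edge set: only the classical decidability
instances ever apply to it). -/
def nearEdges (ends : E → Sym2 V) (s t w : V) : Set E := within ends (near ends s t w)

omit [Fintype E] [Fintype V] in
/-- Membership in the near edges. -/
lemma mem_nearEdges {s t w : V} {e : E} :
    e ∈ nearEdges ends s t w ↔ ∃ x ∈ near ends s t w, ∃ y ∈ near ends s t w, ends e = s(x, y) :=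
  Iff.rfl

omit [Fintype E] [Fintype V] in
/-- **Edges from beyond `z` stay beyond `z` or return to `z`**: if `v` is on the side of neither
`x` nor `y` at `z` (`x, y ≠ z`) and `{v, v'}` is an edge, then `v' = z` or `v'` is on the side of
neither `x` nor `y`. -/
lemma beyond_of_openAdj {z x y v v' : V} (hxz : x ≠ z) (hyz : y ≠ z)
    (hv : v ∉ GateSide.side ends z x) (hv' : v ∉ GateSide.side ends z y) {ω : Config E}
    (hadj : OpenAdj ends ω v v') (hvz : v ≠ z) :
    v' = z ∨ (v' ∉ GateSide.side ends z x ∧ v' ∉ GateSide.side ends z y) := by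
  by_cases hv'z : v' = z
  · exact Or.inl hv'z
  · refine Or.inr ⟨fun h => hv ?_, fun h => hv' ?_⟩
    · exact GateSide.mem_side_of_openAdj hxz h hadj.symm hvz
    · exact GateSide.mem_side_of_openAdj hyz h hadj.symm hvz

end Near

/-! ## The two events of the class-B mass are events of `G[near]` -/

section Events

variable {ends : E → Sym2 V}

omit [Fintype E] [Fintype V] in
/-- An open edge of `G` whose ends lie in the near region is an open edge of `G[near]`. -/
lemma openAdj_resF_of_mem {s t w : V} {ω : Config E} {x y : V} (hx : x ∈ near ends s t w)
    (hy : y ∈ near ends s t w) (h : OpenAdj ends ω x y) :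
    OpenAdj (endsR (nearEdges ends s t w) ends) (resF (nearEdges ends s t w) ω) x y := by
  obtain ⟨e, he, hends⟩ := h
  exact ⟨⟨e, mem_nearEdges.2 ⟨x, hx, y, hy, hends⟩⟩, he, hends⟩

omit [Fintype E] [Fintype V] in
/-- **The cluster event through the near region**: for `W ⊆ N` all of whose `G`-neighbours lie in
`N`, `{C_G(s) = W} = {C_{G[N]}(s) = W}` pulled back. -/
lemma clusterEvent_eq_preimage {s t w : V} {W : Finset V} (hW : ↑W ⊆ near ends s t w)
    (hcl : ∀ x ∈ W, ∀ y, (∃ e, ends e = s(x, y)) → y ∈ near ends s t w) :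
    clusterEvent ends s (↑W : Set V) =
      resF (nearEdges ends s t w) ⁻¹'
        clusterEvent (endsR (nearEdges ends s t w) ends) s (↑W : Set V) := by
  ext ω
  simp only [Set.mem_preimage, mem_clusterEvent]
  constructor
  · intro hC
    apply Set.Subset.antisymm
    · intro x hx
      have hxW : x ∈ W := by
        have : x ∈ cluster ends ω s := conn_of_connR _ hx
        rw [hC] at this; exact this
      exact Finset.mem_coe.2 hxW
    · intro x hx
      have hxC : Conn ends ω s x := by
        have : x ∈ cluster ends ω s := by rw [hC]; exact hx
        exact this
      -- closure: `v ∉ W ∨ s ↔ v in G[N]`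
      let S : Set V := {v | v ∉ W ∨ Conn (endsR (nearEdges ends s t w) ends) (resF (nearEdges ends s t w) ω) s v}
      have hS : ∀ v ∈ S, ∀ v', (openGraph ends ω).Adj v v' → v' ∈ S := by
        intro v hv v' hadj
        by_cases hv'W : v' ∈ W
        · obtain ⟨_, hadj'⟩ := openGraph_adj.1 hadj
          have hvW : v ∈ W := by
            by_contra hvn
            have : v ∈ cluster ends ω s := by
              have hv'c : v' ∈ cluster ends ω s := by rw [hC]; exact Finset.mem_coe.2 hv'W
              exact conn_trans hv'c (conn_of_openAdj hadj'.symm)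
            rw [hC] at this
            exact hvn (Finset.mem_coe.1 this)
          rcases hv with hv | hv
          · exact (hv hvW).elim
          · exact Or.inr (conn_trans hv (conn_of_openAdj
              (openAdj_resF_of_mem (hW (Finset.mem_coe.2 hvW)) (hW (Finset.mem_coe.2 hv'W)) hadj')))
        · exact Or.inl hv'W
      have hxS : x ∈ S := mem_of_conn_of_closed hS (Or.inr (conn_refl _ _ _)) hxC
      rcases hxS with h | h
      · exact (h (Finset.mem_coe.1 hx)).elim
      · exact h
  · intro hC
    apply Set.Subset.antisymm
    · intro y hy
      -- closure: `W` is closed under open `G`-adjacency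
      have hS : ∀ v ∈ (↑W : Set V), ∀ v', (openGraph ends ω).Adj v v' → v' ∈ (↑W : Set V) := by
        intro v hv v' hadj
        obtain ⟨_, e, he, hends⟩ := openGraph_adj.1 hadj
        have hv'N : v' ∈ near ends s t w := hcl v (Finset.mem_coe.1 hv) v' ⟨e, hends⟩
        have hvC : v ∈ cluster (endsR (nearEdges ends s t w) ends) (resF (nearEdges ends s t w) ω) s := by
          rw [hC]; exact hv
        have : v' ∈ cluster (endsR (nearEdges ends s t w) ends) (resF (nearEdges ends s t w) ω) s :=
          conn_trans hvC (conn_of_openAdj (openAdj_resF_of_mem (hW hv) hv'N ⟨e, he, hends⟩))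
        rw [hC] at this
        exact this
      have hsW : s ∈ (↑W : Set V) := by
        rw [← hC]; exact mem_cluster_self _ _ _
      exact mem_of_conn_of_closed hS hsW hy
    · intro x hx
      have : x ∈ cluster (endsR (nearEdges ends s t w) ends) (resF (nearEdges ends s t w) ω) s := by
        rw [hC]; exact hx
      exact conn_of_connR _ this

omit [Fintype E] in
/-- The restricted configuration of `G[N]` is the restriction of the restricted configuration. -/
lemma restrict_resF_eq (F : Set E) (W : Finset V) (ω : Config E) :
    restrict (touches (endsR F ends) (↑W : Set V))ᶜ (resF F ω) =
      resF F (restrict (touches ends (↑W : Set V))ᶜ ω) := by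
  funext e
  have hiff : e ∈ (touches (endsR F ends) (↑W : Set V))ᶜ ↔
      e.1 ∈ (touches ends (↑W : Set V))ᶜ := Iff.rfl
  by_cases h : e.1 ∈ (touches ends (↑W : Set V))ᶜ
  · rw [restrict_apply_of_mem (hiff.2 h)]
    show ω e.1 = restrict (touches ends (↑W : Set V))ᶜ ω e.1
    rw [restrict_apply_of_mem h]
  · rw [restrict_apply_of_notMem (fun h' => h (hiff.1 h'))]
    show false = restrict (touches ends (↑W : Set V))ᶜ ω e.1
    rw [restrict_apply_of_notMem h]

omit [Fintype E] in
/-- **The hull connection through the near region**: `{t ↔ w in G ∖ W} = {t ↔ w in G[N] ∖ W}`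
pulled back, `N = near s t w` (no excursion beyond `t` or beyond `w` is ever needed). -/
lemma connDelEvent_eq_preimage {s t w : V} (hst : s ≠ t) (hsw : s ≠ w) (htw : t ≠ w)
    (W : Finset V) :
    connDelEvent ends W t w =
      resF (nearEdges ends s t w) ⁻¹' connDelEvent (endsR (nearEdges ends s t w) ends) W t w := by
  ext ω
  simp only [Set.mem_preimage, mem_connDelEvent, restrict_resF_eq]
  set ω' := restrict (touches ends (↑W : Set V))ᶜ ω with hω'
  constructor
  · intro h
    -- the closure set: reached in `G[N] ∖ W`, or beyond `t`, or (beyond `w` once `t ↔ w` is known)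
    let Bt : Set V := {v | v ∉ GateSide.side ends t s ∧ v ∉ GateSide.side ends t w ∧ v ≠ t}
    let Bw : Set V := {v | v ∉ GateSide.side ends w s ∧ v ∉ GateSide.side ends w t ∧ v ≠ w}
    let S : Set V := {v | Conn (endsR (nearEdges ends s t w) ends) (resF (nearEdges ends s t w) ω') t v ∨
      v ∈ Bt ∨ (Conn (endsR (nearEdges ends s t w) ends) (resF (nearEdges ends s t w) ω') t w ∧ v ∈ Bw)}
    have hNt : ∀ v, v ∉ near ends s t w → v ∈ Bt ∨ v ∈ Bw := by
      intro v hv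
      by_cases h1 : v ∈ GateSide.side ends w s ∪ GateSide.side ends w t ∪ {w}
      · have h2 : v ∉ GateSide.side ends t s ∪ GateSide.side ends t w ∪ {t} := fun h2 => hv ⟨h1, h2⟩
        simp only [Set.mem_union, Set.mem_singleton_iff, not_or] at h2
        exact Or.inl ⟨h2.1.1, h2.1.2, h2.2⟩
      · simp only [Set.mem_union, Set.mem_singleton_iff, not_or] at h1
        exact Or.inr ⟨h1.1.1, h1.1.2, h1.2⟩
    -- a vertex reached in `G[N]` lies in `N`
    have hreach : ∀ v, Conn (endsR (nearEdges ends s t w) ends) (resF (nearEdges ends s t w) ω') t v → v ∈ near ends s t w := by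
      intro v hv
      by_cases hvt : v = t
      · rw [hvt]; exact t_mem_near htw
      · obtain ⟨q⟩ := hv
        cases hq : q.reverse with
        | nil => exact (hvt rfl).elim
        | cons hadj₂ _ =>
          rw [openGraph_adj] at hadj₂
          obtain ⟨_, e₂, _, hends₂⟩ := hadj₂
          have hmem : v ∈ endsR (nearEdges ends s t w) ends e₂ := by
            rw [hends₂]; exact Sym2.mem_mk_left _ _
          obtain ⟨a, ha, b, hb, hab⟩ := mem_nearEdges.1 e₂.2
          have hmem' : v ∈ ends e₂.1 := hmem
          rw [hab, Sym2.mem_iff] at hmem'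
          rcases hmem' with rfl | rfl
          · exact ha
          · exact hb
    have hS : ∀ v ∈ S, ∀ v', (openGraph ends ω').Adj v v' → v' ∈ S := by
      intro v hv v' hadj
      obtain ⟨_, e, he, hends⟩ := openGraph_adj.1 hadj
      have he' := restrict_eq_true_iff.1 he
      have hadjG : OpenAdj ends ω v v' := ⟨e, he'.1, hends⟩
      rcases hv with hv | hv | ⟨htw', hv⟩
      · have hvN := hreach v hv
        by_cases hv'N : v' ∈ near ends s t w
        · exact Or.inl (conn_trans hv (conn_of_openAdj
            ⟨⟨e, mem_nearEdges.2 ⟨v, hvN, v', hv'N, hends⟩⟩, he, hends⟩))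
        · rcases hNt v' hv'N with hB | hB
          · exact Or.inr (Or.inl hB)
          · -- an edge into the region beyond `w` comes from `w`
            by_cases hvw : v = w
            · rw [hvw] at hv
              exact Or.inr (Or.inr ⟨hv, hB⟩)
            · exfalso
              rcases beyond_of_openAdj (z := w) (x := s) (y := t) hsw htw hB.1 hB.2.1 (ω := ω)
                  hadjG.symm hB.2.2 with h1 | h1
              · exact hvw h1
              · rcases hvN.1 with (h2 | h2) | h2
                · exact h1.1 h2
                · exact h1.2 h2
                · exact hvw (Set.mem_singleton_iff.1 h2)
      · -- `v` beyond `t`: `v'` is `t` or beyond `t`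
        by_cases hv't : v' = t
        · rw [hv't]; exact Or.inl (conn_refl _ _ _)
        · rcases beyond_of_openAdj (z := t) (x := s) (y := w) hst htw.symm hv.1 hv.2.1 (ω := ω)
              hadjG hv.2.2 with h1 | h1
          · exact (hv't h1).elim
          · exact Or.inr (Or.inl ⟨h1.1, h1.2, hv't⟩)
      · -- `v` beyond `w` (with `t ↔ w` known): `v'` is `w` or beyond `w`
        by_cases hv'w : v' = w
        · rw [hv'w]; exact Or.inl htw'
        · rcases beyond_of_openAdj (z := w) (x := s) (y := t) hsw htw hv.1 hv.2.1 (ω := ω)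
              hadjG hv.2.2 with h1 | h1
          · exact (hv'w h1).elim
          · exact Or.inr (Or.inr ⟨htw', h1.1, h1.2, hv'w⟩)
    have hwS : w ∈ S := mem_of_conn_of_closed hS (Or.inl (conn_refl _ _ _)) h
    rcases hwS with h | h | ⟨h, _⟩
    · exact h
    · exact (h.2.1 (GateSide.mem_side_self t w)).elim
    · exact h
  · intro h
    exact conn_of_connR _ h

end Events


end GateNear

end Summit.Ventures.PercRepro2
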